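import Summits.QuantumFields.YangMills.Theorems.UnitScaleTiltProp7StubEXOfChartPiecesTwS3S
import Summits.QuantumFields.YangMills.Theorems.UnitScaleTiltProp7ChartWOfCov
import Summits.QuantumFields.YangMills.Theorems.UnitScaleTiltMinimiserStabilityRegPrPV3EChart
import HarnessLib

/-!
# [v3.2ˢ = ✓`Prop7StubEXOfChartPiecesTwS4` (v3.1ˢ) WITH THE THEOREM-2 SOCKET IN `Thm2SetupSUAt` CURRENCY — the weakest currency both consumers need (COV ✓`cov_of_thm2SetupSUAt`,
# based binder ✓`thm2Based_of_thm2SetupSUAt`), matching lit-balaban's endpoint ✓`B8Thm2T3FamilyBinder.hThm2_of_constants` (A13); ★★OWNER g27 ACK 55 (1), socket owner's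
# word (T-b) 2026-08-28 12:46Z; everything else below VERBATIM.]
# Route `UnitScaleTilt`, crux K1 child «MinimiserStabilityRegPr» (stmt-QuantumFields-19200), skeleton v10, stub `stub_existenceMinimalOrbit` (EX), route (α) — **THE EX KNIT AT THE
# CHART OF RECORD AND THE SYMMETRIC SLICE, v3.1ˢ: CHART_W PROVED FROM THE KNIT'S OWN THEOREM-2 SOCKET READ AT THE CRITICAL BACKGROUND; THE GROWTH SIDE DISPLAYS ONE ROW IN
# E′'s LETTERS** (knit lineage, 2026-08-28; on top of the knit of record v3.0ˢ ✓`Prop7StubEXOfChartPiecesTwS3`).  The opaque slice `Tsl`, the window `aW` and the two rows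
# CHART_W ∕ LOCMIN_W of v3.0ˢ are DISCHARGED: `Tsl L i W :=` the tautological slice {`D` Hermitian-traceless, `A(W) ≤ A(e^{iD}W)`} (LOCMIN_W is its definition), `aW L :=`
# the seven thresholds of ✓`…PV3EChart.isMinOn_regFibrePr_of_thm2_coercive142_at` and of COV at `W` divided by `178`, and CHART_W is PROVED at the critical background
# `W = (e^{iX}U₀)^u ∈ (6)(178ε₄) ∩ 𝔅_k(V)` from (a) `W` MINIMISES over (6)(178ε₄) ∩ 𝔅_k(V) — ★w4-19200's E′ chart theorem ✓`isMinOn_regFibrePr_of_thm2_coercive142_at` with the BASED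
# Theorem-2 binder at `W` derived from the knit's socket `hThm2` (✓`Prop7ChartWOfCov.thm2Based_member_of_thm2TorusAt`) and the displayed P-row `hcoW` — and (b) the competitor's
# chart exponent at `W` from COV at `W` (✓`Prop7ChartWOfCov.exists_hermChart_of_cov_at` over ✓`cov_of_thm2TorusAt` at `B₃ := 1`).  So the EX knit's growth side now displays
# EXACTLY ONE row, `hcoW` = [Balaban1985Variational] (141)–(142) in the Landau chart at the critical background, in the letters of E′'s `hco`
# (✓`…PV3EChart.stub_PV3E_of_thm2_coercive142`) with R2-criticality replaced by the knit's E–L clause — ONE supplier text for E′ and EX (the α-P lane: ★p1 g12, ★w4-19200 g4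
# F3–F6, routeR hands), and the Theorem-2 socket `hThm2` serves COV at `U₀`, the chart at `W`, and E′.

Cell `ym3-torus`, width seat `ym-ust-19200-w2` (gen 4; EX knit lineage).  THEOREMS ONLY (0 `def`, 0 `sorry`).  CONDITIONAL: this file does NOT close the stub — the remaining
inputs are displayed hypotheses with named suppliers; `--supports stmt-QuantumFields-19200 --as helper`, count-neutral.  YM₃ on T³ is a ladder rung (R3), not the Clay problem;
nothing here claims the stub, the crux, d = 4 or the mass gap.

THE PRINT.  [Balaban1985Variational] p. 299: *«To see that U_k is a minimum we apply the whole procedure with the configuration U_k instead of U₀. We get a functional 𝒜(A′)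
for which the critical configuration is equal to 0 … (141) … (142) A second order differential at A′ = 0 is given by the quadratic form above, and it is positive definite.
Hence A′ = 0 is a minimum of the functional and this implies that U_k is a minimal configuration of the functional A(U)»*.  EX DISPLAY after this file (hypotheses, by
name): constants `B₀ C₄ a₃ α r M c₀ cB BH ef ε′`; N06 ×2 `norm_G`∕`norm_H₁`; P4 `prop4`; (45)–(46)-twˢ `h46tw` (+ `H` real); (WF) `hWe`∕`hWε`; `hMe`; (W137) `hw137`; `hBH0`;
(W47q)∕(W47R); `h102`∕`h129`; `h102L`∕`h129L`; `hrε`; (R-H₁) `hH₁R`; (R-𝒢) `h𝒢R`; (R-W) `hWR`; `hrα`∕`hr4`∕`hr16`; `hXtw‴` (XL: (112) ∘ (123)–(140) ∘ E–L); **(P) `hcoW`**;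
T2 `hThm2`.  REMOVED relative to v3.0ˢ: `aW haW`, `Tsl`, `hChartW`, `hLocW`.

WHAT IS PROVED (sorry-free, no definition).  ★★★ **`stubEX_of_chartPiecesTwS4`** — the REGISTERED text of `stub_existenceMinimalOrbit` (all `L > 1`, all `B₃ > 4`) from the
displayed rows: ✓`stubEX_of_chartPiecesTwS3` at the tautological slice, `aW` from the sockets' constants (`choose`), `hLocW` by definition, `hChartW` by (a) + (b) above and
the gauge invariance of (5) (✓`T4WilsonGaugeFlatDirection.wilsonAction_gaugeAct`), the competitor's axial copy lying in (6)(178ε₄) ∩ 𝔅_k(V) by [B8] Prop. 7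
(✓`regPr_emb15_of_in19`).

References: T. Bałaban, CMP 102 (1985) 277–309 [Balaban1985Variational]; CMP 99 (1985) 75–102 [Balaban1985RegularSpaces]; CMP 99 (1985) 389–434 [Balaban1985BackgroundPropagators];
CMP 98 (1985) 17–51 [Balaban1985Averaging] (loci in the theorem docstring).
-/

set_option autoImplicit false

noncomputable section

open scoped BigOperators Matrix.Norms.L2Operator Matrix

namespace Summit.QuantumFields.YangMills.Theorems.Prop7StubEXOfChartPiecesTwS5

open NormedSpace
open Literature.MathematicalPhysics.QuantumFieldTheory.Balaban1983to89
open Literature.MathematicalPhysics.QuantumFieldTheory.Balaban1983to89.T3ContinuumYM3Torus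
open Literature.MathematicalPhysics.QuantumFieldTheory.Balaban1983to89.T3UnitLawDensityEML (ℰp)
open Literature.MathematicalPhysics.QuantumFieldTheory.Balaban1983to89.T3TiltDescent (descendTo)
open Literature.MathematicalPhysics.QuantumFieldTheory.Balaban1983to89.T3ConstrainedMinimiser (fibre)
open Literature.MathematicalPhysics.QuantumFieldTheory.Balaban1983to89.T3PrintedRegularMinimiser (RegPr regFibrePr)
open Literature.MathematicalPhysics.QuantumFieldTheory.Balaban1983to89.T3PrintedRegularOrbits (descTransf)
open Literature.MathematicalPhysics.QuantumFieldTheory.Balaban1983to89.T3PrintedMinimiserExistence (regPr_mono)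
open Literature.MathematicalPhysics.QuantumFieldTheory.Balaban1983to89.T3Thm1Carrier
open Literature.MathematicalPhysics.QuantumFieldTheory.Balaban1983to89.T3SectALandauChart (In19 emb15 CloseAvg eta bgUnits pert)
open BlockAveragingEMLLinearisedBackground (pertVar)
open B9SectCLatticeCarrier (Bond)
open B10Eq27TorusAxialLog (unitsField toUField pull)
open B11Eq115Space (NegSup NegSize Space115 JetSup)
open B11Eq111FrakG (nabla115)
open B11Eq98CurrentSlot (Jcur)
open B11Prop3Model (Dfix)
open B13Contraction113 (QuadAnalytic)
open B8Thm2SetupTorus (Thm2SetupSUAt)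
open B8Thm2TorusAt (Cond135T C136T C139T)
open B8Thm4TorusAt (torusLam)
open B8Eq138LandauZd (IsLandau138)
open B7Prop1Explicit renaming Site → LSite
open B7Prop2SpecialUnitary (specialUnitaryUnits)
open MatrixLog (mlog)
open Summit.QuantumFields.YangMills.Theorems.Prop7TPrint (nMax19 expHermField)
open Summit.QuantumFields.YangMills.Theorems.Prop7SPrint (AvgCondPrint AvgCondPrintS NormS IsLandauPrint IsLandauPrintS basePt RestrictedPrint IsAxialPrint)
open Summit.QuantumFields.YangMills.Theorems.Prop7SectET3Transport (periodsT3 siteEquiv siteEquiv_shiftEquiv bgOfCfg bondEquiv)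
open Summit.QuantumFields.YangMills.Theorems.Prop7SymAvgTwSym (dbarTwS QTwS CmapTwS Chart47T3twS)
open Summit.QuantumFields.YangMills.Theorems.Prop7Bound20SymLog (bound20_symLog_of_closeAvg)
open Summit.QuantumFields.YangMills.Theorems.Prop7ChartPiecesTwG (hChart_of_piecesTwG hXtw_of_split_etaG hXtw'_of_splitG)
open Summit.QuantumFields.YangMills.Theorems.Prop7StubEXOfChartPiecesTwS3S (stubEX_of_chartPiecesTwS3S)
open Summit.QuantumFields.YangMills.Theorems.Prop7ChartWOfCov (exists_hermChart_of_cov_at)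
open Summit.QuantumFields.YangMills.Theorems.Prop7SPrintThm2Dict (thm2Based_of_thm2SetupSUAt)
open Summit.QuantumFields.YangMills.Theorems.PV3EChart (isMinOn_regFibrePr_of_thm2_coercive142_at)
open Summit.QuantumFields.YangMills.Theorems.Prop7CovOfThm2 (cov_of_thm2SetupSUAt)
open B7Prop2Explicit (C0 c2' C0_pos c2'_pos)
open Literature.MathematicalPhysics.QuantumFieldTheory.Balaban1983to89.T3PrintedRegularOrbits (regPr_gaugeAct_iff)
open Literature.MathematicalPhysics.QuantumFieldTheory.Balaban1983to89.T3PrintedRegularMinimiser (mem_regFibrePr_iff)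
open Summit.QuantumFields.YangMills.Theorems.Prop7StubEXOfChartPiecesTwSR (bsym_isHermitian_trace_zero)
open Summit.QuantumFields.YangMills.Theorems.Prop7SolutionRealityRowS (hA₁R_of_letterReality)
open Summit.QuantumFields.YangMills.Theorems.Prop7DbarTwSymWindow (dbarTwS_window_of_regPr)
open Summit.QuantumFields.YangMills.Theorems.Prop7CmapTwSymInputs (chart47twS_of_regPr_eta)
open Summit.QuantumFields.YangMills.Theorems.Prop7StubEXOfChartPiecesTwL (windows_of_admissible three_le_memberL)
open Summit.QuantumFields.YangMills.Theorems.Prop7StubEXOfChartPiecesTwS (windows_of_W)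
open Summit.QuantumFields.YangMills.Theorems.Prop7SymSliceWitness (exists_normS_of_regPr_of_size)
open Summit.QuantumFields.YangMills.Theorems.Prop7DbarTwWindow (norm_smul_I_le_of_nMax19_lt)
open Summit.QuantumFields.YangMills.Theorems.Prop7B8Prop7Div (regPr_emb15_of_in19)
open Summit.QuantumFields.YangMills.Theorems.Prop7PV3CDELogChart (in19_expHermField_of_nMax19_lt)
open Summit.QuantumFields.YangMills.Theorems.Prop7ChartRealityRowS (hXtw''_of_reality)

variable {L : ℕ}

/-! ## §0 The based Theorem-2 binder at one member from the `Thm2SetupSUAt` socket -/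

/-- ★ **THE BASED THEOREM-2 BINDER AT ONE MEMBER FROM THE v3.2ˢ SOCKET** (`Thm2SetupSUAt` currency): at the member `(F, n, K)` the BASED binder `hT2m` of
✓`…PV3EChart.isMinOn_regFibrePr_of_thm2_coercive142_at` holds with the same `B₁, c₁` (✓`thm2Based_of_thm2SetupSUAt`, repackaging `β₀ B₂ len`).
[cite: Balaban1985RegularSpaces, Thm 2 p.83, (1.33)-(1.39) pp.82-83; Balaban1985Variational, Prop. 2 p.281] -/
theorem thm2Based_member_of_thm2SetupSUAt {L : ℕ} {B₁ c₁ : ℝ}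
    (hT : ∀ (F : T3Family), F.L = L → ∀ (n K : ℕ), n < K →
      ∃ (β₀ B₂ : ℝ) (len : LSite (F.P K).d → ℝ),
        Thm2SetupSUAt (F.P K) 2 (K - n) (eta F n K) β₀ B₁ B₂ c₁ len (fun _ => True))
    (F : T3Family) (hF : F.L = L) {n K : ℕ} (hnK : n < K) :
    ∀ (α₀ α₁ : ℝ), 0 < α₀ → 0 < α₁ → α₀ + α₁ ≤ c₁ →
      ∀ (U₀ U : GaugeField (F.P K) 0 (Matrix.specialUnitaryGroup (Fin 2) ℂ)),
        RegPr F n K α₀ U₀ → RegPr F n K α₀ U → IsAxialPrint F n K U₀ U →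
        Cond135T (F.P K).L (K - n) (pull (bgUnits F K U₀) (basePt F n K)) (pull (bgUnits F K (pert U₀ U)) (basePt F n K)) α₁ →
        ∃ (u : GaugeTransf (F.P K) 0 (Matrix.specialUnitaryGroup (Fin 2) ℂ))
          (U₁ : GaugeField (F.P K) 0 (Matrix.specialUnitaryGroup (Fin 2) ℂ)) (A : PBond (F.P K) 0 → Matrix (Fin 2) (Fin 2) ℂ),
          RestrictedPrint F n K U₀ u ∧ GaugeField.gaugeAct u (emb15 U₀ U₁) = U ∧ (∀ b : PBond (F.P K) 0, IsSelfAdjoint (A b)) ∧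
          (∀ b : PBond (F.P K) 0,
            ((U₁ b : Matrix.specialUnitaryGroup (Fin 2) ℂ) : Matrix (Fin 2) (Fin 2) ℂ) = exp (Complex.I • ((eta F n K) • A b))) ∧
          (∃ (β₀ B₂ : ℝ) (len : LSite (F.P K).d → ℝ),
            C136T (F.P K).L (K - n) (eta F n K) β₀ B₁ B₂ len (α₀ + α₁) (pull (bgUnits F K U₀) (basePt F n K))
              (pull A (basePt F n K))) ∧
          IsLandau138 (F.P K).L (K - n) (eta F n K) (Set.univ : Set (LSite (F.P K).d)) (torusLam (K - n))
            (pull (bgUnits F K U₀) (basePt F n K)) (pull A (basePt F n K)) ∧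
          C139T (F.P K).L (K - n) (eta F n K) B₁ (α₀ + α₁) (pull (bgUnits F K U₀) (basePt F n K)) (pull A (basePt F n K)) := by
  intro α₀ α₁ hα₀ hα₁ hc U₀ U h₀ hU hax h35
  obtain ⟨β₀, B₂, len, h⟩ := hT F hF n K hnK
  obtain ⟨u, U₁, A, h1, h2, h3, h4, h36, h38, h39⟩ :=
    thm2Based_of_thm2SetupSUAt F h hα₀ hα₁ hc U₀ U h₀ hU hax h35
  exact ⟨u, U₁, A, h1, h2, h3, h4, ⟨β₀, B₂, len, h36⟩, h38, h39⟩

/-! ## §1 The knit v3.2ˢ -/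

/-- ★★★ **`stub_existenceMinimalOrbit`'s REGISTERED TEXT FROM THE PIECES OF THE CHART OF RECORD, v3.1ˢ — CHART_W PROVED, THE GROWTH SIDE = ONE ROW `hcoW` IN E′'s LETTERS.**
As ✓`stubEX_of_chartPiecesTwS3` (v3.0ˢ) but the opaque slice `Tsl`, the window `aW` and the rows CHART_W ∕ LOCMIN_W are DISCHARGED (tautological slice; `W = (e^{iX}U₀)^u` minimises
over (6)(178ε₄) ∩ 𝔅_k(V) by ★w4's ✓`isMinOn_regFibrePr_of_thm2_coercive142_at` with Theorem 2 BASED AT `W` from the socket `hThm2` and the displayed P-row `hcoW`; the competitor's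
chart exponent at `W` by COV at `W`, ✓`exists_hermChart_of_cov_at`), and the growth side displays the single row `hcoW`: (141)–(142) in the Landau chart at the critical
background — every Theorem-2 chart point `U₁W`, `U₁ = e^{iηA}`, (1.36)∕(1.38)∕(1.39) at radius `α ≤ c₇`, whose (1.29)-restricted `u`-image lies in (6)(e) ∩ 𝔅_k(V), has
`A(W) ≤ A(U₁W)`, for `W ∈ (6)(e) ∩ 𝔅_k(V)` E–L-critical (the knit's clause), `e ≤ e₇`.  PROVENANCE (for DEPMAP v3.19, ★★OWNER ACK 51): `hcoW` ≙ E′'s `hco` — the second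
hypothesis of ✓`PV3EChart.stub_PV3E_of_thm2_coercive142` — VERBATIM with [`IsCritR2 F n K hnK.le V U →` ↦ the E–L clause; letter `U` ↦ `W`]; NOT a new node: its supplier is
the α-P lane's single junction (ONE supplier text for E′ and EX).  CONDITIONAL — the stub is not closed.
[cite: Balaban1985Variational, Prop. 7 p.299, (141)-(142) p.299, Prop. 2 p.281, (5) p.278, (51) p.286, (47)–(49) p.285, (103) p.293, (111)–(112) p.294, Props 5–6 pp.294–296, (19)–(21) p.281; Balaban1985RegularSpaces, Thm 2 p.83, (1.35)–(1.39) pp.82–83; Balaban1985BackgroundPropagators, Thm 3.12 p.420, (3.124) p.420] -/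
theorem stubEX_of_chartPiecesTwS5
    [hFL : ∀ F : T3Family, Fact (0 < (F.L : ℝ))] [hFη : ∀ (F : T3Family) (k : ℕ), Fact (0 < ((F.L : ℝ)⁻¹) ^ k)]
    -- the constants, member-uniform at each `L` (print: «absolute constants depending on d and L only»)
    (B₀ C₄ a₃ α r M : ℕ → ℝ) (hB₀ : ∀ L, 1 < L → 0 < B₀ L) (hC₄ : ∀ L, 1 < L → 0 < C₄ L) (ha₃ : ∀ L, 1 < L → 0 < a₃ L)
    (hα : ∀ L, 1 < L → 0 < α L) (hr : ∀ L, 1 < L → 0 < r L) (hM : ∀ L, 1 < L → 0 < M L)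
    -- the `L²` weights of the projected Landau condition (21)ˢ `IsLandauPrintS` (display place (d); print: `c₀ = η³`, `cB = 1`)
    (c₀ cB : ℕ → ℝ) [hc₀ : ∀ L : ℕ, Fact (0 < c₀ L)]
    -- the curved letters `𝔊(U₀)`, `(δ/δA′)V`, `H₁(U₀)`, OPAQUE (the datum `B` is FIXED to `Bsym` on `Λ_k = PBond (P n) 0`)
    (𝒢f : ∀ (L : ℕ) (i : Idx L) (U₀ : GaugeField (i.1.1.P i.1.2.2) 0 (Matrix.specialUnitaryGroup (Fin 2) ℂ)),
      NegSize (i.1.1.L : ℝ) (((i.1.1.L : ℝ)⁻¹) ^ (i.1.2.2 - i.1.2.1)) (fun _ : Bond 3 (periodsT3 i.1.1 i.1.2.2) => i.1.2.2 - i.1.2.1) 3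
          (Matrix (Fin 2) (Fin 2) ℂ) →L[ℂ]
        Space115 (i.1.1.L : ℝ) (((i.1.1.L : ℝ)⁻¹) ^ (i.1.2.2 - i.1.2.1)) (fun _ : Bond 3 (periodsT3 i.1.1 i.1.2.2) => i.1.2.2 - i.1.2.1)
          (fun _ : Bond 3 (periodsT3 i.1.1 i.1.2.2) × Fin 3 => i.1.2.2 - i.1.2.1) (nabla115 (((i.1.1.L : ℝ)⁻¹) ^ (i.1.2.2 - i.1.2.1)) (bgOfCfg i.1.1 i.1.2.2 U₀)))
    (Wf : ∀ (L : ℕ) (i : Idx L) (U₀ : GaugeField (i.1.1.P i.1.2.2) 0 (Matrix.specialUnitaryGroup (Fin 2) ℂ)),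
      Space115 (i.1.1.L : ℝ) (((i.1.1.L : ℝ)⁻¹) ^ (i.1.2.2 - i.1.2.1)) (fun _ : Bond 3 (periodsT3 i.1.1 i.1.2.2) => i.1.2.2 - i.1.2.1)
          (fun _ : Bond 3 (periodsT3 i.1.1 i.1.2.2) × Fin 3 => i.1.2.2 - i.1.2.1) (nabla115 (((i.1.1.L : ℝ)⁻¹) ^ (i.1.2.2 - i.1.2.1)) (bgOfCfg i.1.1 i.1.2.2 U₀)) →
        NegSize (i.1.1.L : ℝ) (((i.1.1.L : ℝ)⁻¹) ^ (i.1.2.2 - i.1.2.1)) (fun _ : Bond 3 (periodsT3 i.1.1 i.1.2.2) => i.1.2.2 - i.1.2.1) 3 (Matrix (Fin 2) (Fin 2) ℂ))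
    (H₁f : ∀ (L : ℕ) (i : Idx L) (U₀ : GaugeField (i.1.1.P i.1.2.2) 0 (Matrix.specialUnitaryGroup (Fin 2) ℂ)),
      (PBond (i.1.1.P i.1.2.1) 0 → Matrix (Fin 2) (Fin 2) ℂ) →L[ℂ]
        Space115 (i.1.1.L : ℝ) (((i.1.1.L : ℝ)⁻¹) ^ (i.1.2.2 - i.1.2.1)) (fun _ : Bond 3 (periodsT3 i.1.1 i.1.2.2) => i.1.2.2 - i.1.2.1)
          (fun _ : Bond 3 (periodsT3 i.1.1 i.1.2.2) × Fin 3 => i.1.2.2 - i.1.2.1) (nabla115 (((i.1.1.L : ℝ)⁻¹) ^ (i.1.2.2 - i.1.2.1)) (bgOfCfg i.1.1 i.1.2.2 U₀)))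
    -- their displayed bounds (the `SectEDatum` fields at admissible backgrounds)
    (norm_G : ∀ (L : ℕ), 1 < L → ∀ (i : Idx L) (ρ : ℝ) (U₀ : GaugeField (i.1.1.P i.1.2.2) 0 (Matrix.specialUnitaryGroup (Fin 2) ℂ)),
      RegPr i.1.1 i.1.2.1 i.1.2.2 ρ U₀ → ρ ≤ α L → ∀ f, ‖𝒢f L i U₀ f‖ ≤ B₀ L * ‖f‖)
    (prop4 : ∀ (L : ℕ), 1 < L → ∀ (i : Idx L) (ρ : ℝ) (U₀ : GaugeField (i.1.1.P i.1.2.2) 0 (Matrix.specialUnitaryGroup (Fin 2) ℂ)),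
      RegPr i.1.1 i.1.2.1 i.1.2.2 ρ U₀ → ρ ≤ α L → QuadAnalytic (Wf L i U₀) (C₄ L) (a₃ L))
    (norm_H₁ : ∀ (L : ℕ), 1 < L → ∀ (i : Idx L) (ρ : ℝ) (U₀ : GaugeField (i.1.1.P i.1.2.2) 0 (Matrix.specialUnitaryGroup (Fin 2) ℂ)),
      RegPr i.1.1 i.1.2.1 i.1.2.2 ρ U₀ → ρ ≤ α L → ∀ b, ‖H₁f L i U₀ b‖ ≤ B₀ L * ‖b‖)
    -- (45)–(46)-twˢ AT ITS η-ORDER, against the chart of record `Q := QTwS U₀`, (45) in the projected form `IsLandauPrintS` (d): print's letter `H` — `QH = I`, `RD*H = 0` (45), `‖HY‖ ≤ B_H·η·‖Y‖` (46), η = L^{−(K−n)} (DISPLAYED; supplier of record: [Balaban1985BackgroundPropagators]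
    -- Thm 3.12 for `H` (3.126), (3.133) n = 0,1 ⊕ (2.61); T³ statement p607026 `normH₁_row_of_recordObligations` with `Hsel := Hk`; O(η) = pure scaling `H_route = η·H_print`)
    (BH : ℕ → ℝ)
    (h46tw : ∀ (L : ℕ), 1 < L → ∀ (i : Idx L) (U₀ : GaugeField (i.1.1.P i.1.2.2) 0 (Matrix.specialUnitaryGroup (Fin 2) ℂ)), RegPr i.1.1 i.1.2.1 i.1.2.2 (α L) U₀ →
      ∃ H : (PBond (i.1.1.P i.1.2.1) 0 → Matrix (Fin 2) (Fin 2) ℂ) →ₗ[ℂ] (PBond (i.1.1.P i.1.2.2) 0 → Matrix (Fin 2) (Fin 2) ℂ),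
        (∀ Y, QTwS i.1.1 i.1.2.1 i.1.2.2 i.2.2.le U₀ (H Y) = Y) ∧ (∀ Y, IsLandauPrintS i.1.1 i.1.2.1 i.1.2.2 i.2.2.le (c₀ L) (cB L) U₀ (H Y)) ∧
        (∀ Y, ‖H Y‖ ≤ BH L * eta i.1.1 i.1.2.1 i.1.2.2 * ‖Y‖) ∧
        (∀ Y, (∀ c, star (Y c) = -Y c ∧ (Y c).trace = 0) → ∀ b', star (H Y b') = -H Y b' ∧ (H Y b').trace = 0))
    -- the radius `e L` of the witness ∕ window theorems and the two L-only numerals (WF) of W3 ∕ W5 ∕ the witness (replace (WΣ))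
    (ef : ℕ → ℝ) (hef : ∀ L, 1 < L → 0 < ef L)
    (hWe : ∀ L : ℕ, 1 < L → 10 ^ 9 * (L : ℝ) ^ 2 * ef L ≤ 1) (hWε : ∀ L : ℕ, 1 < L → 10 ^ 12 * (L : ℝ) ^ 3 * α L ≤ 1)
    -- the size window linking (CH5EL-twˢ)'s size row to the witness ∕ window radius, and the regularity window of the chart point
    (hMe : ∀ L, 1 < L → M L * (r L + 2 * B₀ L * α L) < ef L)
    (hw137 : ∀ L : ℕ, 1 < L → 10 ^ 7 * (L : ℝ) ^ 3 * (178 * (α L + ef L)) ≤ 1)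
    -- (CH47-twˢ) IS A THEOREM here (✓`Prop7CmapTwSymInputs.chart47twS_of_regPr_eta`): Prop. 3 for the chart of record at `C₂ := 40M₀ˢ∕(e·η)²`, `M₀ˢ = 6(2e + 2700Lε₀)`, radius `η·ε′`; its two η-free windows are displayed
    (ε' : ℕ → ℝ) (hBH0 : ∀ L : ℕ, 1 < L → 0 ≤ BH L)
    (hq47 : ∀ L : ℕ, 1 < L → 9 * (40 * (2 * (3 * (2 * ef L + 2700 * (L : ℝ) * α L))) / ef L ^ 2) * BH L * ε' L < 1)
    (hR6 : ∀ L : ℕ, 1 < L → 6 * ε' L ≤ ef L)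
    -- (102)-twS «Q𝔊 = 0» and (129)-twS «QH₁ = id» for print's `Q(U₀) = η·(QTwS U₀ ∘ ι)`, read through the (115)-space dictionary `ι` (DISPLAYED, N06-class rows about the opaque letters)
    (h102 : ∀ (L : ℕ), 1 < L → ∀ (i : Idx L) (U₀ : GaugeField (i.1.1.P i.1.2.2) 0 (Matrix.specialUnitaryGroup (Fin 2) ℂ)), RegPr i.1.1 i.1.2.1 i.1.2.2 (α L) U₀ →
      ∀ f : NegSize (i.1.1.L : ℝ) (((i.1.1.L : ℝ)⁻¹) ^ (i.1.2.2 - i.1.2.1)) (fun _ : Bond 3 (periodsT3 i.1.1 i.1.2.2) => i.1.2.2 - i.1.2.1) 3 (Matrix (Fin 2) (Fin 2) ℂ),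
        QTwS i.1.1 i.1.2.1 i.1.2.2 i.2.2.le U₀ (fun b : PBond (i.1.1.P i.1.2.2) 0 => JetSup.equiv _ _ _ (𝒢f L i U₀ f) (bondEquiv i.1.1 i.1.2.2 b)) = 0)
    (h129 : ∀ (L : ℕ), 1 < L → ∀ (i : Idx L) (U₀ : GaugeField (i.1.1.P i.1.2.2) 0 (Matrix.specialUnitaryGroup (Fin 2) ℂ)), RegPr i.1.1 i.1.2.1 i.1.2.2 (α L) U₀ →
      ∀ B : PBond (i.1.1.P i.1.2.1) 0 → Matrix (Fin 2) (Fin 2) ℂ,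
        QTwS i.1.1 i.1.2.1 i.1.2.2 i.2.2.le U₀ (fun b : PBond (i.1.1.P i.1.2.2) 0 => JetSup.equiv _ _ _ (H₁f L i U₀ B) (bondEquiv i.1.1 i.1.2.2 b)) =
          fun c => (((eta i.1.1 i.1.2.1 i.1.2.2 : ℝ) : ℂ))⁻¹ • B c)
    -- (102)-L «R_S D*𝔊 = 0» and (129)-L «R_S D*H₁ = 0» ((3.124)-S) in the projected form `IsLandauPrintS` (d), read through `ι` (DISPLAYED; definitional for the S suppliers)
    (h102L : ∀ (L : ℕ), 1 < L → ∀ (i : Idx L) (U₀ : GaugeField (i.1.1.P i.1.2.2) 0 (Matrix.specialUnitaryGroup (Fin 2) ℂ)), RegPr i.1.1 i.1.2.1 i.1.2.2 (α L) U₀ →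
      ∀ f : NegSize (i.1.1.L : ℝ) (((i.1.1.L : ℝ)⁻¹) ^ (i.1.2.2 - i.1.2.1)) (fun _ : Bond 3 (periodsT3 i.1.1 i.1.2.2) => i.1.2.2 - i.1.2.1) 3 (Matrix (Fin 2) (Fin 2) ℂ),
        IsLandauPrintS i.1.1 i.1.2.1 i.1.2.2 i.2.2.le (c₀ L) (cB L) U₀ (fun b : PBond (i.1.1.P i.1.2.2) 0 => JetSup.equiv _ _ _ (𝒢f L i U₀ f) (bondEquiv i.1.1 i.1.2.2 b)))
    (h129L : ∀ (L : ℕ), 1 < L → ∀ (i : Idx L) (U₀ : GaugeField (i.1.1.P i.1.2.2) 0 (Matrix.specialUnitaryGroup (Fin 2) ℂ)), RegPr i.1.1 i.1.2.1 i.1.2.2 (α L) U₀ →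
      ∀ B : PBond (i.1.1.P i.1.2.1) 0 → Matrix (Fin 2) (Fin 2) ℂ,
        IsLandauPrintS i.1.1 i.1.2.1 i.1.2.2 i.2.2.le (c₀ L) (cB L) U₀ (fun b : PBond (i.1.1.P i.1.2.2) 0 => JetSup.equiv _ _ _ (H₁f L i U₀ B) (bondEquiv i.1.1 i.1.2.2 b)))
    -- the chart-radius window (exponent scale): print's `A′ = A₁ + H₁B` of (103) lies in the `ε₃`-ball of Prop. 3-tw, `η(r + 2B₀α) ≤ ε₃`
    (hrε : ∀ L : ℕ, 1 < L → r L + 2 * B₀ L * α L ≤ ε' L)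
    -- (R-H₁) the letter `H₁(U₀)` is REAL: Hermitian-traceless data ↦ Hermitian-traceless-valued (115)-fields (DISPLAYED, N06-class clause on the `norm_H₁` letter)
    (hH₁R : ∀ (L : ℕ), 1 < L → ∀ (i : Idx L) (U₀ : GaugeField (i.1.1.P i.1.2.2) 0 (Matrix.specialUnitaryGroup (Fin 2) ℂ)), RegPr i.1.1 i.1.2.1 i.1.2.2 (α L) U₀ →
      ∀ B : PBond (i.1.1.P i.1.2.1) 0 → Matrix (Fin 2) (Fin 2) ℂ, (∀ c, (B c).IsHermitian ∧ (B c).trace = 0) →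
        ∀ b' : PBond (i.1.1.P i.1.2.2) 0, (JetSup.equiv _ _ _ (H₁f L i U₀ B) (bondEquiv i.1.1 i.1.2.2 b')).IsHermitian ∧
          (JetSup.equiv _ _ _ (H₁f L i U₀ B) (bondEquiv i.1.1 i.1.2.2 b')).trace = 0)
    -- (R-𝒢) the letter `𝔊(U₀)` is REAL: Hermitian-traceless (−3)-data ↦ Hermitian-traceless (115)-fields (DISPLAYED, N06-class clause on the `norm_G` letter)
    (h𝒢R : ∀ (L : ℕ), 1 < L → ∀ (i : Idx L) (U₀ : GaugeField (i.1.1.P i.1.2.2) 0 (Matrix.specialUnitaryGroup (Fin 2) ℂ)), RegPr i.1.1 i.1.2.1 i.1.2.2 (α L) U₀ →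
      ∀ f : NegSize (i.1.1.L : ℝ) (((i.1.1.L : ℝ)⁻¹) ^ (i.1.2.2 - i.1.2.1)) (fun _ : Bond 3 (periodsT3 i.1.1 i.1.2.2) => i.1.2.2 - i.1.2.1) 3 (Matrix (Fin 2) (Fin 2) ℂ),
        (∀ b, (NegSup.equiv _ _ f b).IsHermitian ∧ (NegSup.equiv _ _ f b).trace = 0) →
        ∀ b, (JetSup.equiv _ _ _ (𝒢f L i U₀ f) b).IsHermitian ∧ (JetSup.equiv _ _ _ (𝒢f L i U₀ f) b).trace = 0)
    -- (R-W) the letter `(δ∕δA′)V` is REAL on its ball: Hermitian-traceless (115)-fields ↦ Hermitian-traceless (−3)-data (DISPLAYED, P4-class clause on the `prop4` letter)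
    (hWR : ∀ (L : ℕ), 1 < L → ∀ (i : Idx L) (U₀ : GaugeField (i.1.1.P i.1.2.2) 0 (Matrix.specialUnitaryGroup (Fin 2) ℂ)), RegPr i.1.1 i.1.2.1 i.1.2.2 (α L) U₀ →
      ∀ A : Space115 (i.1.1.L : ℝ) (((i.1.1.L : ℝ)⁻¹) ^ (i.1.2.2 - i.1.2.1)) (fun _ : Bond 3 (periodsT3 i.1.1 i.1.2.2) => i.1.2.2 - i.1.2.1)
          (fun _ : Bond 3 (periodsT3 i.1.1 i.1.2.2) × Fin 3 => i.1.2.2 - i.1.2.1) (nabla115 (((i.1.1.L : ℝ)⁻¹) ^ (i.1.2.2 - i.1.2.1)) (bgOfCfg i.1.1 i.1.2.2 U₀)),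
        ‖A‖ < a₃ L → (∀ b, (JetSup.equiv _ _ _ A b).IsHermitian ∧ (JetSup.equiv _ _ _ A b).trace = 0) →
        ∀ b, (NegSup.equiv _ _ (Wf L i U₀ A) b).IsHermitian ∧ (NegSup.equiv _ _ (Wf L i U₀ A) b).trace = 0)
    -- the three `L`-only windows putting `ε₄ := r` in Prop. 6's uniqueness regime (118)∕(121)
    (hrα : ∀ L : ℕ, 1 < L → 2 * B₀ L * α L ≤ r L) (hr4 : ∀ L : ℕ, 1 < L → 4 * r L ≤ a₃ L) (hr16 : ∀ L : ℕ, 1 < L → 16 * B₀ L * C₄ L * r L ≤ 1)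
    -- (CH5EL-twˢ)‴: (112) ∘ (123)–(140) ((19)-size) ∘ E–L (at the `NormS`-representatives) at print's `A′ = A₁ + H₁B` in the exponent scale `iη·(ι A₁ + ι(H₁B))`, for the REAL `H` of (45)–(46)-twˢ, chart remainder `Dfix (CmapTwS U₀)` (DISPLAYED, XL; no (20), (21), datum, NO REALITY — Prop. 5's «X is 𝔤-valued» is now proved)
    (hXtw''' : ∀ (L : ℕ), 1 < L → ∀ (i : Idx L) (ε₁ : ℝ) (V : GaugeField (i.1.1.P i.1.2.1) 0 (Matrix.specialUnitaryGroup (Fin 2) ℂ))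
      (U₀ : GaugeField (i.1.1.P i.1.2.2) 0 (Matrix.specialUnitaryGroup (Fin 2) ℂ))
      (H : (PBond (i.1.1.P i.1.2.1) 0 → Matrix (Fin 2) (Fin 2) ℂ) →ₗ[ℂ] (PBond (i.1.1.P i.1.2.2) 0 → Matrix (Fin 2) (Fin 2) ℂ)), 0 < ε₁ → PlaqSmall ε₁ V →
      RegPr i.1.1 i.1.2.1 i.1.2.2 ((L : ℝ) ^ 3 * (3 * (L : ℝ)) * ε₁) U₀ → CloseAvg i.1.1 i.1.2.1 i.1.2.2 i.2.2.le ((L : ℝ) ^ 3 * ε₁) V U₀ → (L : ℝ) ^ 3 * (3 * (L : ℝ)) * ε₁ ≤ α L →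
      (∀ Y, QTwS i.1.1 i.1.2.1 i.1.2.2 i.2.2.le U₀ (H Y) = Y) → (∀ Y, IsLandauPrintS i.1.1 i.1.2.1 i.1.2.2 i.2.2.le (c₀ L) (cB L) U₀ (H Y)) →
      (∀ Y, ‖H Y‖ ≤ BH L * eta i.1.1 i.1.2.1 i.1.2.2 * ‖Y‖) →
      (∀ Y, (∀ c, star (Y c) = -Y c ∧ (Y c).trace = 0) → ∀ b', star (H Y b') = -H Y b' ∧ (H Y b').trace = 0) → Chart47T3twS i.1.1 i.1.2.1 i.1.2.2 i.2.2.le (40 * (2 * (3 * (2 * ef L + 2700 * (i.1.1.L : ℝ) * α L))) / (ef L * eta i.1.1 i.1.2.1 i.1.2.2) ^ 2) (eta i.1.1 i.1.2.1 i.1.2.2 * ε' L) U₀ H →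
      ∀ A₁ : Space115 (i.1.1.L : ℝ) (((i.1.1.L : ℝ)⁻¹) ^ (i.1.2.2 - i.1.2.1)) (fun _ : Bond 3 (periodsT3 i.1.1 i.1.2.2) => i.1.2.2 - i.1.2.1)
          (fun _ : Bond 3 (periodsT3 i.1.1 i.1.2.2) × Fin 3 => i.1.2.2 - i.1.2.1) (nabla115 (((i.1.1.L : ℝ)⁻¹) ^ (i.1.2.2 - i.1.2.1)) (bgOfCfg i.1.1 i.1.2.2 U₀)),
        ‖A₁‖ < r L →
        A₁ + 𝒢f L i U₀ (Jcur (bgOfCfg i.1.1 i.1.2.2 U₀)) + 𝒢f L i U₀ (Wf L i U₀ (A₁ + H₁f L i U₀ (fun c : PBond (i.1.1.P i.1.2.1) 0 =>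
          (-Complex.I) • mlog (((V c : Matrix.specialUnitaryGroup (Fin 2) ℂ) : Matrix (Fin 2) (Fin 2) ℂ)
            * star ((descendTo i.1.1 ℰp i.1.2.1 i.1.2.2 i.2.2.le U₀ c : Matrix.specialUnitaryGroup (Fin 2) ℂ) : Matrix (Fin 2) (Fin 2) ℂ))))) = 0 →
        ∃ X : PBond (i.1.1.P i.1.2.2) 0 → Matrix (Fin 2) (Fin 2) ℂ,
          (((eta i.1.1 i.1.2.1 i.1.2.2 : ℝ) : ℂ) * Complex.I) • ((fun b : PBond (i.1.1.P i.1.2.2) 0 => JetSup.equiv _ _ _ A₁ (bondEquiv i.1.1 i.1.2.2 b))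
              + (fun b : PBond (i.1.1.P i.1.2.2) 0 => JetSup.equiv _ _ _ (H₁f L i U₀ (fun c : PBond (i.1.1.P i.1.2.1) 0 =>
          (-Complex.I) • mlog (((V c : Matrix.specialUnitaryGroup (Fin 2) ℂ) : Matrix (Fin 2) (Fin 2) ℂ)
            * star ((descendTo i.1.1 ℰp i.1.2.1 i.1.2.2 i.2.2.le U₀ c : Matrix.specialUnitaryGroup (Fin 2) ℂ) : Matrix (Fin 2) (Fin 2) ℂ)))) (bondEquiv i.1.1 i.1.2.2 b)))
            - H (Dfix (CmapTwS i.1.1 i.1.2.1 i.1.2.2 i.2.2.le U₀) H (40 * (2 * (3 * (2 * ef L + 2700 * (i.1.1.L : ℝ) * α L))) / (ef L * eta i.1.1 i.1.2.1 i.1.2.2) ^ 2)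
              ((((eta i.1.1 i.1.2.1 i.1.2.2 : ℝ) : ℂ) * Complex.I) • ((fun b : PBond (i.1.1.P i.1.2.2) 0 => JetSup.equiv _ _ _ A₁ (bondEquiv i.1.1 i.1.2.2 b))
              + (fun b : PBond (i.1.1.P i.1.2.2) 0 => JetSup.equiv _ _ _ (H₁f L i U₀ (fun c : PBond (i.1.1.P i.1.2.1) 0 =>
          (-Complex.I) • mlog (((V c : Matrix.specialUnitaryGroup (Fin 2) ℂ) : Matrix (Fin 2) (Fin 2) ℂ)
            * star ((descendTo i.1.1 ℰp i.1.2.1 i.1.2.2 i.2.2.le U₀ c : Matrix.specialUnitaryGroup (Fin 2) ℂ) : Matrix (Fin 2) (Fin 2) ℂ)))) (bondEquiv i.1.1 i.1.2.2 b)))))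
            = (fun b => Complex.I • X b) ∧
          nMax19 i.1.1 i.1.2.1 i.1.2.2 U₀ X ≤ M L * (‖A₁‖ + ‖H₁f L i U₀ (fun c : PBond (i.1.1.P i.1.2.1) 0 =>
          (-Complex.I) • mlog (((V c : Matrix.specialUnitaryGroup (Fin 2) ℂ) : Matrix (Fin 2) (Fin 2) ℂ)
            * star ((descendTo i.1.1 ℰp i.1.2.1 i.1.2.2 i.2.2.le U₀ c : Matrix.specialUnitaryGroup (Fin 2) ℂ) : Matrix (Fin 2) (Fin 2) ℂ)))‖) ∧
          (∀ u : GaugeTransf (i.1.1.P i.1.2.2) 0 (Matrix.specialUnitaryGroup (Fin 2) ℂ), NormS i.1.1 i.1.2.1 i.1.2.2 i.2.2.le U₀ X (expHermField X) u →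
            GaugeField.gaugeAct u (emb15 U₀ (expHermField X)) ∈ fibre i.1.1 ℰp i.1.2.1 i.1.2.2 i.2.2.le V →
            ∀ γ : ℝ → GaugeField (i.1.1.P i.1.2.2) 0 (Matrix.specialUnitaryGroup (Fin 2) ℂ), γ 0 = GaugeField.gaugeAct u (emb15 U₀ (expHermField X)) →
              (∀ t, γ t ∈ fibre i.1.1 ℰp i.1.2.1 i.1.2.2 i.2.2.le V) →
              (∀ b, DifferentiableAt ℝ (fun t => ((γ t b : Matrix.specialUnitaryGroup (Fin 2) ℂ) : Matrix (Fin 2) (Fin 2) ℂ)) 0) →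
                deriv (fun t => wilsonAction4 (γ t)) 0 = 0))
    -- (P) THE ONE GROWTH ROW — [Balaban1985Variational] (141)–(142) IN THE LANDAU CHART AT THE CRITICAL BACKGROUND, in E′'s `hco` LETTERS (✓`…PV3EChart.stub_PV3E_of_thm2_coercive142`)
    -- with R2-criticality replaced by the knit's E–L clause (stationarity along bondwise-differentiable fibre curves): every Theorem-2 chart point `U₁W`, `U₁ = e^{iηA}`,
    -- (1.36)∕(1.38)∕(1.39) at radius `α ≤ c₇`, whose (1.29)-restricted `u`-image lies in (6)(e) ∩ 𝔅_k(V), has `A(W) ≤ A(U₁W)` (DISPLAYED; the α-P lane's row)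
    (hcoW : ∀ (L : ℕ), 1 < L → ∀ (B₁ : ℝ), 0 < B₁ → ∃ e₇ c₇ : ℝ, 0 < e₇ ∧ 0 < c₇ ∧
      ∀ (F : T3Family), F.L = L → ∀ (n K : ℕ) (hnK : n < K) (e α : ℝ) (V : GaugeField (F.P n) 0 (Matrix.specialUnitaryGroup (Fin 2) ℂ))
        (W U₁ : GaugeField (F.P K) 0 (Matrix.specialUnitaryGroup (Fin 2) ℂ)) (u : GaugeTransf (F.P K) 0 (Matrix.specialUnitaryGroup (Fin 2) ℂ))
        (A : PBond (F.P K) 0 → Matrix (Fin 2) (Fin 2) ℂ),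
        0 < e → e ≤ e₇ → 0 < α → α ≤ c₇ → W ∈ regFibrePr F n K hnK.le e V →
        (∀ γ : ℝ → GaugeField (F.P K) 0 (Matrix.specialUnitaryGroup (Fin 2) ℂ), γ 0 = W → (∀ t, γ t ∈ fibre F ℰp n K hnK.le V) →
          (∀ b, DifferentiableAt ℝ (fun t => ((γ t b : Matrix.specialUnitaryGroup (Fin 2) ℂ) : Matrix (Fin 2) (Fin 2) ℂ)) 0) →
            deriv (fun t => wilsonAction4 (γ t)) 0 = 0) →
        RestrictedPrint F n K W u → (∀ b : PBond (F.P K) 0, IsSelfAdjoint (A b)) →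
        (∀ b : PBond (F.P K) 0, ((U₁ b : Matrix.specialUnitaryGroup (Fin 2) ℂ) : Matrix (Fin 2) (Fin 2) ℂ) = exp (Complex.I • ((eta F n K) • A b))) →
        (∃ (β₀ B₂ : ℝ) (len : B7Prop1Explicit.Site (F.P K).d → ℝ),
          B8Thm2TorusAt.C136T (F.P K).L (K - n) (eta F n K) β₀ B₁ B₂ len α (pull (bgUnits F K W) (basePt F n K)) (pull A (basePt F n K))) →
        B8Eq138LandauZd.IsLandau138 (F.P K).L (K - n) (eta F n K) (Set.univ : Set (B7Prop1Explicit.Site (F.P K).d)) (B8Thm4TorusAt.torusLam (K - n))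
          (pull (bgUnits F K W) (basePt F n K)) (pull A (basePt F n K)) →
        B8Thm2TorusAt.C139T (F.P K).L (K - n) (eta F n K) B₁ α (pull (bgUnits F K W) (basePt F n K)) (pull A (basePt F n K)) →
        GaugeField.gaugeAct u (emb15 W U₁) ∈ regFibrePr F n K hnK.le e V →
          wilsonAction4 W ≤ wilsonAction4 (emb15 W U₁))
    -- (T2) the [B8] Thm 2 sockets AT THE SETUP-TORUS OBJECTS (`Thm2SetupSUAt`, rider dropped), one `(B₁, c₁)` per `L` (v3.2ˢ currency — the weakest both consumers need)
    (hThm2S : ∀ (L : ℕ), 1 < L → ∃ B₁ c₁ : ℝ, 0 < B₁ ∧ 0 < c₁ ∧ ∀ (F : T3Family), F.L = L → ∀ (n K : ℕ), n < K →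
      ∃ (β₀ B₂ : ℝ) (len : B7Prop1Explicit.Site (F.P K).d → ℝ),
        Thm2SetupSUAt (F.P K) 2 (K - n) (eta F n K) β₀ B₁ B₂ c₁ len (fun _ => True)) :
    ∀ (L : ℕ), 1 < L → ∀ (B₃ : ℝ), 4 < B₃ → ∃ a₁' O₁ : ℝ, 0 < a₁' ∧ 1 ≤ O₁ ∧
    ∀ (F : T3Family), F.L = L → ∀ (n K : ℕ) (hnK : n < K) (ε₁ : ℝ), 0 < ε₁ →
      ∀ V : GaugeField (F.P n) 0 (Matrix.specialUnitaryGroup (Fin 2) ℂ), PlaqSmall ε₁ V →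
        ∀ U₀ : GaugeField (F.P K) 0 (Matrix.specialUnitaryGroup (Fin 2) ℂ), RegPr F n K ((L : ℝ) ^ 3 * B₃ * ε₁) U₀ → U₀ ∈ fibre F ℰp n K hnK.le V →
          ε₁ ≤ a₁' → ∃ U ∈ regFibrePr F n K hnK.le (O₁ * (L : ℝ) ^ 3 * B₃ * ε₁) V,
            IsMinOn (fun W : GaugeField (F.P K) 0 (Matrix.specialUnitaryGroup (Fin 2) ℂ) => wilsonAction4 W)
              (regFibrePr F n K hnK.le (O₁ * (L : ℝ) ^ 3 * B₃ * ε₁) V) U := by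
  classical
  -- the constants of the two sockets: Theorem 2's `(B₁, c₁)` per `L`, COV at `B₃ := 1` from them (`B₁′, c₁′`), and the P-row's `(e₇, c₇)` at `B₁`
  have hT2 := hThm2S
  choose! B₁ c₁ hB₁ hc₁ hT using hT2
  have hC : ∀ L : ℕ, 1 < L → ∃ B₁' c₁' : ℝ, 0 < B₁' ∧ 0 < c₁' ∧ _ := fun L hL => cov_of_thm2SetupSUAt (B₃ := 1) zero_le_one (hB₁ L hL) (hc₁ L hL) (hT L hL)
  choose! B₁' c₁' hB₁' hc₁' hCOV using hC
  choose! e₇ c₇ he₇ hc₇ hco using fun L hL => hcoW L hL (B₁ L) (hB₁ L hL)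
  -- the window `aW` at the critical background: all thresholds of the E′ chart theorem and of COV@W, divided by 178 (`e := 178ε₄`)
  refine stubEX_of_chartPiecesTwS3S B₀ C₄ a₃ α r M
    (fun L => min (min (min (min (min (min (1 / (6 * C0 3 * 1)) (c2' 3 L / (4 * 1))) ((10 ^ 8 * (L : ℝ) ^ 3)⁻¹))
      (c₁ L / (2 + 2 * (2 * (14336 + 21 / 20 * (((5 * (L : ℝ)) ^ 2 / 4) * (10800 * (L : ℝ) + 1)))))))
      (c₇ L / (2 + 2 * (2 * (14336 + 21 / 20 * (((5 * (L : ℝ)) ^ 2 / 4) * (10800 * (L : ℝ) + 1))))))) (e₇ L)) (c₁' L / 2) / 178)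
    hB₀ hC₄ ha₃ hα hr hM ?_ c₀ cB 𝒢f Wf H₁f norm_G prop4 norm_H₁ BH h46tw ef hef hWe hWε hMe hw137 ε' hBH0 hq47 hR6 h102 h129 h102L h129L hrε hH₁R h𝒢R hWR
    hrα hr4 hr16 hXtw'''
    -- the TAUTOLOGICAL slice at the critical background: Hermitian-traceless directions along which `W` does not lose action (LOCMIN_W is then its definition;
    -- all content sits in CHART_W, proved below from the E′ chart theorem — consuming `hcoW` — and COV at `W`)
    (fun L i W => {D | (∀ b : PBond (i.1.1.P i.1.2.2) 0, (D b).IsHermitian ∧ Matrix.trace (D b) = 0) ∧ wilsonAction4 W ≤ wilsonAction4 (emb15 W (expHermField D))})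
    ?_ (fun L _ i ε₁ ε₄ V U₀ X u W _ _ _ _ _ _ _ _ _ _ _ _ _ _ _ D hD _ => hD.2) hThm2S
  · -- `0 < aW L`
    intro L hL
    have hL0 : (0 : ℝ) < (L : ℝ) := by exact_mod_cast (show 0 < L by omega)
    have h1 := C0_pos 3
    have h2 := c2'_pos 3 L (by omega)
    have h3 := hc₁ L hL
    have h4 := hc₇ L hL
    have h5 := he₇ L hL
    have h6 := hc₁' L hL
    positivity
  · -- CHART_W at the critical background `W = (e^{iX}U₀)^u`, from the E′ chart theorem (IsMinOn over (6)(178ε₄) ∩ 𝔅_k(V)) and COV at `W`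
    intro L hL i ε₁ ε₄ V U₀ X u W hε₁ hε₄4 hε₄W hlo hV hreg _hclose hXh hXε _h20 _h21 _hu hWdef hWfib hEL X' hX'ε hX'h h20' _h21'
    obtain ⟨⟨F, n, K⟩, hF, hnK⟩ := i
    simp only [Set.mem_setOf_eq] at hWdef hWfib hEL hreg hXε h20' hX'ε ⊢
    set CL : ℝ := 2 * (14336 + 21 / 20 * (((5 * (L : ℝ)) ^ 2 / 4) * (10800 * (L : ℝ) + 1))) with hCL_def
    have hL0 : (0 : ℝ) < (L : ℝ) := by exact_mod_cast (show 0 < L by omega)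
    have hFL : (F.L : ℝ) = (L : ℝ) := by exact_mod_cast hF
    have hCL0 : 0 ≤ CL := by positivity
    have hD : 0 < 2 + 2 * CL := by positivity
    -- the thresholds carried by `ε₄ ≤ aW L`, for `e := 178ε₄`
    set m : ℝ := min (min (min (min (min (min (1 / (6 * C0 3 * 1)) (c2' 3 L / (4 * 1))) ((10 ^ 8 * (L : ℝ) ^ 3)⁻¹)) (c₁ L / (2 + 2 * CL)))
      (c₇ L / (2 + 2 * CL))) (e₇ L)) (c₁' L / 2) with hm
    have hem : 178 * ε₄ ≤ m := by
      have : ε₄ ≤ m / 178 := hε₄W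
      linarith
    have heA : 178 * ε₄ ≤ min (1 / (6 * C0 3 * 1)) (c2' 3 L / (4 * 1)) :=
      hem.trans ((min_le_left _ _).trans ((min_le_left _ _).trans ((min_le_left _ _).trans ((min_le_left _ _).trans (min_le_left _ _)))))
    have he8 : 178 * ε₄ ≤ (10 ^ 8 * (F.L : ℝ) ^ 3)⁻¹ := by
      rw [hFL]; exact hem.trans ((min_le_left _ _).trans ((min_le_left _ _).trans ((min_le_left _ _).trans ((min_le_left _ _).trans (min_le_right _ _)))))
    have hec₁ : (2 + 2 * (2 * (14336 + 21 / 20 * (((5 * (F.L : ℝ)) ^ 2 / 4) * (10800 * (F.L : ℝ) + 1))))) * (178 * ε₄) ≤ c₁ L := by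
      rw [hFL, ← hCL_def]
      have h := hem.trans ((min_le_left _ _).trans ((min_le_left _ _).trans ((min_le_left _ _).trans (min_le_right _ _))))
      rwa [le_div_iff₀ hD, mul_comm] at h
    have hec₇ : (2 + 2 * (2 * (14336 + 21 / 20 * (((5 * (F.L : ℝ)) ^ 2 / 4) * (10800 * (F.L : ℝ) + 1))))) * (178 * ε₄) ≤ c₇ L := by
      rw [hFL, ← hCL_def]
      have h := hem.trans ((min_le_left _ _).trans ((min_le_left _ _).trans (min_le_right _ _)))
      rwa [le_div_iff₀ hD, mul_comm] at h
    have he₇' : 178 * ε₄ ≤ e₇ L := hem.trans ((min_le_left _ _).trans (min_le_right _ _))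
    have hec' : 178 * ε₄ + 178 * ε₄ ≤ c₁' L := by
      have h := hem.trans (min_le_right _ _)
      linarith
    -- the critical background and the competitor's axial copy lie in (6)(178ε₄) ∩ 𝔅_k(V) ([B8] Prop. 7 through (19))
    have h19 : In19 F n K ε₄ U₀ (expHermField X) X := in19_expHermField_of_nMax19_lt hXh hXε
    have h19' : In19 F n K ε₄ U₀ (expHermField X') X' := in19_expHermField_of_nMax19_lt hX'h hX'ε
    have hε₄0 : 0 < ε₄ := Prop7PV3CDELogChart.pos_of_in19 h19
    have he0 : (0 : ℝ) ≤ 178 * ε₄ := by positivity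
    have hRegW : RegPr F n K (178 * ε₄) W := by
      rw [hWdef]; exact (regPr_gaugeAct_iff F he0 u _).mpr (regPr_emb15_of_in19 (F := F) (n := n) (K := K) hε₄4 hlo hreg h19)
    have hWmem : W ∈ regFibrePr F n K hnK.le (178 * ε₄) V := (mem_regFibrePr_iff F).mpr ⟨hWfib, hRegW⟩
    obtain ⟨u', -, -, hW'fib⟩ := h20' (expHermField X') h19'.2.1
    have hRegW' : RegPr F n K (178 * ε₄) (GaugeField.gaugeAct u' (emb15 U₀ (expHermField X'))) :=
      (regPr_gaugeAct_iff F he0 u' _).mpr (regPr_emb15_of_in19 (F := F) (n := n) (K := K) hε₄4 hlo hreg h19')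
    have hW'mem : GaugeField.gaugeAct u' (emb15 U₀ (expHermField X')) ∈ regFibrePr F n K hnK.le (178 * ε₄) V :=
      (mem_regFibrePr_iff F).mpr ⟨hW'fib, hRegW'⟩
    -- `W` MINIMISES over (6)(178ε₄) ∩ 𝔅_k(V): the E′ chart theorem with Theorem 2 based at `W` (from the socket) and the P-row `hcoW` at `W`
    have hmin := isMinOn_regFibrePr_of_thm2_coercive142_at F hF hnK (c₇ := c₇ L) (thm2Based_member_of_thm2SetupSUAt (hT L hL) F hF hnK) hWmem
      (fun α' u₁ U₁ A hα0 hα7 hru hA hexp h136 h138 h139 hmem =>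
        hco L hL F hF n K hnK (178 * ε₄) α' V W U₁ u₁ A (by positivity) he₇' hα0 hα7 hWmem hEL hru hA hexp h136 h138 h139 hmem)
      heA he8 hec₁ hec₇
    have a2 : wilsonAction4 (GaugeField.gaugeAct u' (emb15 U₀ (expHermField X'))) = wilsonAction4 (emb15 U₀ (expHermField X')) :=
      T4WilsonGaugeFlatDirection.wilsonAction_gaugeAct 1 u' _
    have hle : wilsonAction4 W ≤ wilsonAction4 (emb15 U₀ (expHermField X')) := by
      have h : wilsonAction4 W ≤ wilsonAction4 (GaugeField.gaugeAct u' (emb15 U₀ (expHermField X'))) := hmin hW'mem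
      exact h.trans_eq a2
    -- the chart exponent `D` of the competitor at `W`, from COV at `W`
    obtain ⟨D, hDh, hAD⟩ := exists_hermChart_of_cov_at F hF hnK (hCOV L hL) hWmem hW'mem heA hec'
    have hA' : wilsonAction4 (emb15 U₀ (expHermField X')) = wilsonAction4 (emb15 W (expHermField D)) := a2.symm.trans hAD
    have hmemD : (∀ b : PBond (F.P K) 0, (D b).IsHermitian ∧ Matrix.trace (D b) = 0) ∧ wilsonAction4 W ≤ wilsonAction4 (emb15 W (expHermField D)) :=
      ⟨hDh, hle.trans_eq hA'⟩
    exact ⟨D, hmemD, hDh, hA'⟩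

end Summit.QuantumFields.YangMills.Theorems.Prop7StubEXOfChartPiecesTwS5

end
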